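import Literature.Analysis.FluidPDE.HarmonicBallMeanValue
import Literature.Analysis.FluidPDE.TaoLocalVelocityGradient
import Literature.Analysis.FluidPDE.SelfSimilar
import Literature.Analysis.FluidPDE.WholeSpaceIBP
import HarnessLib

/-!
# Interior gradient bound for the harmonic part of the pressure of a steady solution

Analysis/FluidPDE proof file (everything PROVED, no definitions, no named facts) on the discharge
path of the named facts `Literature.Analysis.FluidPDE.wangYang2026_liouville_velocity_log` and
`…_vorticity_log` (`SteadyNSLiouville.lean`; W. Wang, G. Yang, arXiv:2608.06040, Thms 1.5–1.6).
The proof of those theorems rests on a Caccioppoli-type inequality for the steady system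
`−Δu + (u·∇)u + ∇p = 0`, `div u = 0` on `ℝ³` (their Lemma 4.1, via Bogovskiĭ's operator; the tree
has no Bogovskiĭ operator). We control the pressure instead, in the classical way (Galdi 2011,
proof of Thm X.9.5; Seregin–Šverák, the splitting `p = p₁ + p₂` with `p₂` harmonic): on a large
ball the pressure `p` differs from a Calderón–Zygmund part `P` by a **harmonic** function
`h = p − P`, and the size of `h` is controlled by the interior gradient estimate of this file.

**Main result** (`abs_fderiv_sub_apply_le_of_steady`). Let `(u, p)` be a classical steady
solution (`IsLerayProfile 1 0 u p`, `u, p ∈ C²`), `P ∈ C²`, `R > 0`, and suppose `h = p − P` is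
harmonic on the ball `B(y, 4R)`. Then for every `a`,

  `|Dh(y) a| ≤ ‖a‖ ( R⁻⁵ M₂ ∫_{B̄(y,2R)} |u| + R⁻⁴ M₁ ∫_{B̄(y,2R)} |u|² + R⁻⁴ M₁ ∫_{B̄(y,2R)} |P| )`,

`M₁ = sup ‖Dλ^{1,2}‖`, `M₂ = sup |Δλ^{1,2}|` for the tree's unit smoothing kernel
`λ^{1,2} = Δ((1−θ)Γ)`. Proof: the ball mean-value formula for the gradient of a harmonic
function (`fderiv_apply_eq_integral_newtonFarLaplacian_mul_fderiv`, `HarmonicBallMeanValue`) gives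
`Dh(y)a = ∫ λᴿ(z) ∂ₐh(y−z) dz` with `λᴿ = λ^{R,2R}`; `∂ₐh = ∂ₐp − ∂ₐP` with
`∇p = Δu − (u·∇)u` (the equation); the Laplacian is moved onto `λᴿ` (`∫ λ ΔF = ∫ Δλ F`), the
convective term is integrated by parts using `div u = 0` (`∫ θ⟪(u·∇)u, a⟫ = −∫ (Dθ u)⟪u, a⟫`),
and `∂ₐ` is moved onto `λᴿ` in the `P`-term; the kernel bounds scale as `|Δλᴿ| ≤ R⁻⁵M₂`,
`‖Dλᴿ‖ ≤ R⁻⁴M₁`.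

## References

* G. P. Galdi, *An introduction to the mathematical theory of the Navier–Stokes equations.
  Steady-state problems*, 2nd ed. (2011), proof of Thm X.9.5. [Galdi2011]
* D. Gilbarg, N. S. Trudinger, *Elliptic partial differential equations of second order* (2001),
  Thm 2.10 (interior derivative estimates). [GilbargTrudinger2001]
* W. Wang, G. Yang, arXiv:2608.06040 (2026), Lemma 4.1 (the Bogovskiĭ route avoided here).
  [WangYang2026]
-/

noncomputable section

open MeasureTheory Set Filter Metric InnerProductSpace Function
open scoped RealInnerProductSpace Laplacian Topology

namespace Literature.Analysis.FluidPDE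

/-! ### The unit smoothing kernel: a bound for its Laplacian, and scaling -/

/-- A universal bound for `Δλ^{1,2}` (continuous with compact support). [folklore] -/
theorem exists_bound_laplacian_newtonFarLaplacian_one_two :
    ∃ M₂ : ℝ, 0 ≤ M₂ ∧ ∀ z : EuclideanSpace ℝ (Fin 3), |(Δ (newtonFarLaplacian 1 2)) z| ≤ M₂ := by
  have hc : Continuous (Δ (newtonFarLaplacian 1 2)) :=
    FluidPDE.continuous_laplacian (contDiff_newtonFarLaplacian one_pos one_lt_two (n := 2))
  have hs : HasCompactSupport (Δ (newtonFarLaplacian (1 : ℝ) 2) : EuclideanSpace ℝ (Fin 3) → ℝ) :=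
    (hasCompactSupport_newtonFarLaplacian zero_le_one one_lt_two).mono' fun z hz => by
      contrapose! hz
      simp [FluidPDE.laplacian_eq_zero_of_notMem_tsupport hz]
  obtain ⟨C, hC⟩ := hc.bounded_above_of_compact_support hs
  refine ⟨max C 0, le_max_right _ _, fun z => ?_⟩
  rw [← Real.norm_eq_abs]
  exact (hC z).trans (le_max_left _ _)

/-- **Scaling of `Δλ`**: `λ^{r,2r}(z) = r⁻³λ^{1,2}(z/r)`, so `|Δλ^{r,2r}(z)| ≤ r⁻⁵ M₂`. [folklore] -/
theorem abs_laplacian_newtonFarLaplacian_scale_le {r : ℝ} (hr : 0 < r) {M₂ : ℝ}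
    (hM : ∀ z : EuclideanSpace ℝ (Fin 3), |(Δ (newtonFarLaplacian 1 2)) z| ≤ M₂)
    (z : EuclideanSpace ℝ (Fin 3)) :
    |(Δ (newtonFarLaplacian r (2 * r))) z| ≤ r⁻¹ ^ 5 * M₂ := by
  have hfun : newtonFarLaplacian r (2 * r) = fun w : EuclideanSpace ℝ (Fin 3) =>
      r⁻¹ ^ 3 • newtonFarLaplacian 1 2 (r⁻¹ • w) := by
    funext w
    have := newtonFarLaplacian_scale hr 1 2 w
    rw [mul_one, show r * 2 = 2 * r by ring] at this
    rw [this, smul_eq_mul]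
  rw [hfun, laplacian_const_smul_comp_smul _ _ (inv_ne_zero hr.ne') z, smul_eq_mul, abs_mul,
    show r⁻¹ ^ 3 * r⁻¹ ^ 2 = r⁻¹ ^ 5 by ring, abs_of_nonneg (by positivity)]
  exact mul_le_mul_of_nonneg_left (hM _) (by positivity)

/-! ### Kernel-dominated integrals -/

/-- If `‖Φ(x)‖ ≤ 1_{B̄(y,ρ)}(x) · K g(x)` with `g` continuous, then `‖∫ Φ‖ ≤ K ∫_{B̄(y,ρ)} g`.
[folklore] -/
theorem norm_integral_le_of_indicator_closedBall_le {F : Type*} [NormedAddCommGroup F]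
    [NormedSpace ℝ F] {Φ : EuclideanSpace ℝ (Fin 3) → F} {g : EuclideanSpace ℝ (Fin 3) → ℝ}
    (hg : Continuous g) {y : EuclideanSpace ℝ (Fin 3)} {ρ K : ℝ}
    (hdom : ∀ x, ‖Φ x‖ ≤ (closedBall y ρ).indicator (fun x => K * g x) x) :
    ‖∫ x, Φ x‖ ≤ K * ∫ x in closedBall y ρ, g x := by
  have hgi : IntegrableOn (fun x => K * g x) (closedBall y ρ) :=
    (hg.continuousOn.integrableOn_compact (isCompact_closedBall y ρ)).const_mul K
  calc ‖∫ x, Φ x‖ ≤ ∫ x, (closedBall y ρ).indicator (fun x => K * g x) x :=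
        norm_integral_le_of_norm_le (hgi.integrable_indicator measurableSet_closedBall)
          (Eventually.of_forall hdom)
    _ = K * ∫ x in closedBall y ρ, g x := by
        rw [integral_indicator measurableSet_closedBall, integral_const_mul]

/-! ### The three terms -/

section Terms

variable {R : ℝ} {y a : EuclideanSpace ℝ (Fin 3)} {M₁ M₂ : ℝ}

/-- Points outside `B̄(y, 2R)` correspond to kernel arguments outside the support of `λ^{R,2R}`.
[folklore] -/
theorem notMem_tsupport_newtonFarLaplacian_of_notMem (hR : 0 < R) {x : EuclideanSpace ℝ (Fin 3)}
    (hx : x ∉ closedBall y (2 * R)) : y - x ∉ tsupport (newtonFarLaplacian R (2 * R)) := by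
  intro hmem
  have := tsupport_newtonFarLaplacian_subset hR.le (by linarith : R < 2 * R) hmem
  rw [mem_closedBall_zero_iff] at this
  rw [mem_closedBall, dist_eq_norm, ← norm_neg, neg_sub] at hx
  exact hx this

/-- **The Laplacian term**: `|∫ λᴿ(z) ⟪a, Δu(y−z)⟫ dz| ≤ ‖a‖ R⁻⁵M₂ ∫_{B̄(y,2R)} |u|` (move the
Laplacian onto the kernel, `∫ λ ΔF = ∫ Δλ F` with `F = ⟪a, u(y − ·)⟫`). [folklore] -/
theorem abs_integral_newtonFarLaplacian_mul_inner_laplacian_le (hR : 0 < R)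
    (hM₂ : ∀ z : EuclideanSpace ℝ (Fin 3), |(Δ (newtonFarLaplacian 1 2)) z| ≤ M₂)
    {u : EuclideanSpace ℝ (Fin 3) → EuclideanSpace ℝ (Fin 3)} (hu : ContDiff ℝ 2 u) :
    |∫ z, newtonFarLaplacian R (2 * R) z * ⟪a, (Δ u) (y - z)⟫| ≤
      ‖a‖ * (R⁻¹ ^ 5 * M₂ * ∫ w in closedBall y (2 * R), ‖u w‖) := by
  have h2R : R < 2 * R := by linarith
  have hlam2 : ContDiff ℝ 2 (newtonFarLaplacian R (2 * R)) := contDiff_newtonFarLaplacian hR h2R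
  have hlamc : HasCompactSupport (newtonFarLaplacian R (2 * R)) := hasCompactSupport_newtonFarLaplacian hR.le h2R
  have hM₂0 : 0 ≤ M₂ := (abs_nonneg _).trans (hM₂ 0)
  -- `F = ⟪a, u⟫`, `ΔF = ⟪a, Δu⟫`
  set F : EuclideanSpace ℝ (Fin 3) → ℝ := fun x => ⟪a, u x⟫ with hF
  have hF2 : ContDiff ℝ 2 F := contDiff_const.inner ℝ hu
  have hΔF : ∀ x, (Δ F) x = ⟪a, (Δ u) x⟫ := fun x => by
    have h1 : F = (innerSL ℝ a : EuclideanSpace ℝ (Fin 3) →L[ℝ] ℝ) ∘ u := by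
      funext x; simp [hF]
    rw [h1, (hu.contDiffAt (x := x)).laplacian_CLM_comp_left, Function.comp_apply]
    rfl
  -- move `Δ` onto the kernel
  set f : EuclideanSpace ℝ (Fin 3) → ℝ := fun z => F (y - z) with hf
  have hf2 : ContDiff ℝ 2 f := hF2.comp (contDiff_const.sub contDiff_id)
  have hΔf : ∀ z, (Δ f) z = (Δ F) (y - z) := fun z => laplacian_comp_const_sub F y z
  have hmove : ∫ z, (newtonFarLaplacian R (2 * R)) z * ⟪a, (Δ u) (y - z)⟫ = ∫ z, (Δ (newtonFarLaplacian R (2 * R))) z * F (y - z) := by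
    have h := integral_mul_laplacian_comm hf2 hlam2 hlamc
    simp_rw [hΔf, hΔF] at h
    exact h
  -- change variables and dominate
  have hcv : ∫ z, (Δ (newtonFarLaplacian R (2 * R))) z * F (y - z) = ∫ w, (Δ (newtonFarLaplacian R (2 * R))) (y - w) * F w := by
    have h := integral_sub_left_eq_self (fun z => (Δ (newtonFarLaplacian R (2 * R))) z * F (y - z)) volume y
    simp only [sub_sub_cancel] at h
    exact h.symm
  rw [hmove, hcv]
  have hdom : ∀ w, ‖(Δ (newtonFarLaplacian R (2 * R))) (y - w) * F w‖ ≤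
      (closedBall y (2 * R)).indicator (fun w => ‖a‖ * (R⁻¹ ^ 5 * M₂) * ‖u w‖) w := by
    intro w
    by_cases hw : w ∈ closedBall y (2 * R)
    · rw [indicator_of_mem hw, norm_mul, Real.norm_eq_abs, Real.norm_eq_abs]
      calc |(Δ (newtonFarLaplacian R (2 * R))) (y - w)| * |F w| ≤ (R⁻¹ ^ 5 * M₂) * (‖a‖ * ‖u w‖) :=
            mul_le_mul (abs_laplacian_newtonFarLaplacian_scale_le hR hM₂ _) (abs_real_inner_le_norm _ _)
              (abs_nonneg _) (by positivity)
        _ = ‖a‖ * (R⁻¹ ^ 5 * M₂) * ‖u w‖ := by ring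
    · rw [indicator_of_notMem hw,
        FluidPDE.laplacian_eq_zero_of_notMem_tsupport (notMem_tsupport_newtonFarLaplacian_of_notMem hR hw),
        zero_mul, norm_zero]
  rw [← Real.norm_eq_abs]
  calc ‖∫ w, (Δ (newtonFarLaplacian R (2 * R))) (y - w) * F w‖ ≤ ‖a‖ * (R⁻¹ ^ 5 * M₂) * ∫ w in closedBall y (2 * R), ‖u w‖ :=
        norm_integral_le_of_indicator_closedBall_le hu.continuous.norm hdom
    _ = _ := by ring

/-- **The convective term**: `|∫ λᴿ(z) ⟪a, (u·∇)u(y−z)⟫ dz| ≤ ‖a‖ R⁻⁴M₁ ∫_{B̄(y,2R)} |u|²` for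
divergence-free `u` (with `θ = λᴿ(y − ·)`: `∫ θ ⟪(u·∇)u, a⟫ = −∫ (Dθ u) ⟪u, a⟫`). [folklore] -/
theorem abs_integral_newtonFarLaplacian_mul_inner_convect_le (hR : 0 < R)
    (hM₁ : ∀ z : EuclideanSpace ℝ (Fin 3), ‖fderiv ℝ (newtonFarLaplacian 1 2) z‖ ≤ M₁)
    {u : EuclideanSpace ℝ (Fin 3) → EuclideanSpace ℝ (Fin 3)} (hu : ContDiff ℝ 2 u)
    (hdiv : VectorCalculus.IsDivFree u) :
    |∫ z, newtonFarLaplacian R (2 * R) z * ⟪a, convect u u (y - z)⟫| ≤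
      ‖a‖ * (R⁻¹ ^ 4 * M₁ * ∫ w in closedBall y (2 * R), ‖u w‖ ^ 2) := by
  have h2R : R < 2 * R := by linarith
  have hlam1 : ContDiff ℝ 1 (newtonFarLaplacian R (2 * R)) := contDiff_newtonFarLaplacian hR h2R
  have hlamc : HasCompactSupport (newtonFarLaplacian R (2 * R)) := hasCompactSupport_newtonFarLaplacian hR.le h2R
  have hM₁0 : 0 ≤ M₁ := (norm_nonneg _).trans (hM₁ 0)
  have hu1 : ContDiff ℝ 1 u := hu.of_le one_le_two
  -- change variables (no auxiliary name for `λ(y − ·)`, to keep definitional unfolding cheap)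
  have hθ1 : ContDiff ℝ 1 fun x => (newtonFarLaplacian R (2 * R)) (y - x) := hlam1.comp (contDiff_const.sub contDiff_id)
  have hθc : HasCompactSupport fun x => (newtonFarLaplacian R (2 * R)) (y - x) := by
    refine HasCompactSupport.intro' ((isCompact_closedBall y (2 * R))) isClosed_closedBall fun x hx => ?_
    exact image_eq_zero_of_notMem_tsupport (notMem_tsupport_newtonFarLaplacian_of_notMem hR hx)
  have hcv : ∫ z, (newtonFarLaplacian R (2 * R)) z * ⟪a, convect u u (y - z)⟫ = ∫ x, (newtonFarLaplacian R (2 * R)) (y - x) * ⟪a, convect u u x⟫ := by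
    have h := integral_sub_left_eq_self (fun z => (newtonFarLaplacian R (2 * R)) z * ⟪a, convect u u (y - z)⟫) volume y
    simp only [sub_sub_cancel] at h
    exact h.symm
  -- integration by parts with the test field `w = λ(y − ·) • a`
  have hw1 : ContDiff ℝ 1 fun x => (newtonFarLaplacian R (2 * R)) (y - x) • a := hθ1.smul contDiff_const
  have hwc : HasCompactSupport fun x => (newtonFarLaplacian R (2 * R)) (y - x) • a := by
    refine HasCompactSupport.intro' ((isCompact_closedBall y (2 * R))) isClosed_closedBall fun x hx => ?_
    rw [image_eq_zero_of_notMem_tsupport (notMem_tsupport_newtonFarLaplacian_of_notMem hR hx), zero_smul]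
  have hibp := integral_inner_convect_add_eq_zero hu1 hu1 hw1 hwc
  have hdiv0 : ∫ x, VectorCalculus.divergence u x * ⟪u x, (newtonFarLaplacian R (2 * R)) (y - x) • a⟫ = 0 := by
    simp only [show ∀ x, VectorCalculus.divergence u x = 0 from hdiv, zero_mul, integral_zero]
  have hconv : ∀ x, convect u (fun x => (newtonFarLaplacian R (2 * R)) (y - x) • a) x = (fderiv ℝ (fun x => (newtonFarLaplacian R (2 * R)) (y - x)) x (u x)) • a :=
    fun x => by
    rw [convect, fderiv_smul_const (hθ1.differentiable one_ne_zero x), ContinuousLinearMap.smulRight_apply]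
  have hfd : ∀ x, fderiv ℝ (fun x => (newtonFarLaplacian R (2 * R)) (y - x)) x = -fderiv ℝ (newtonFarLaplacian R (2 * R)) (y - x) := fun x =>
    fderiv_comp_const_sub (newtonFarLaplacian R (2 * R)) y x
  -- `∫ λ(y−x) ⟪a, (u·∇)u⟫ = ∫ ⟪(u·∇)u, λ(y−x) • a⟫ = −∫ ⟪u, (D[λ(y−·)] u) • a⟫`
  have heq : ∫ x, (newtonFarLaplacian R (2 * R)) (y - x) * ⟪a, convect u u x⟫ =
      -∫ x, ⟪u x, (fderiv ℝ (fun x => (newtonFarLaplacian R (2 * R)) (y - x)) x (u x)) • a⟫ := by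
    have h1 : ∫ x, (newtonFarLaplacian R (2 * R)) (y - x) * ⟪a, convect u u x⟫ = ∫ x, ⟪convect u u x, (newtonFarLaplacian R (2 * R)) (y - x) • a⟫ := by
      refine integral_congr_ae (Eventually.of_forall fun x => ?_)
      show newtonFarLaplacian R (2 * R) (y - x) * ⟪a, convect u u x⟫ =
        ⟪convect u u x, newtonFarLaplacian R (2 * R) (y - x) • a⟫
      rw [real_inner_smul_right, real_inner_comm (convect u u x) a]
    rw [h1]
    rw [hdiv0, add_zero] at hibp
    simp_rw [hconv] at hibp
    linarith
  rw [hcv, heq, abs_neg]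
  have hdom : ∀ x, ‖⟪u x, (fderiv ℝ (fun x => (newtonFarLaplacian R (2 * R)) (y - x)) x (u x)) • a⟫‖ ≤
      (closedBall y (2 * R)).indicator (fun x => ‖a‖ * (R⁻¹ ^ 4 * M₁) * ‖u x‖ ^ 2) x := by
    intro x
    rw [hfd]
    by_cases hx : x ∈ closedBall y (2 * R)
    · rw [indicator_of_mem hx]
      calc ‖⟪u x, ((-fderiv ℝ (newtonFarLaplacian R (2 * R)) (y - x)) (u x)) • a⟫‖
          ≤ ‖u x‖ * ‖((-fderiv ℝ (newtonFarLaplacian R (2 * R)) (y - x)) (u x)) • a‖ := norm_inner_le_norm _ _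
        _ = ‖u x‖ * (|fderiv ℝ (newtonFarLaplacian R (2 * R)) (y - x) (u x)| * ‖a‖) := by
            rw [norm_smul, _root_.neg_apply, Real.norm_eq_abs, abs_neg]
        _ ≤ ‖u x‖ * ((R⁻¹ ^ 4 * M₁ * ‖u x‖) * ‖a‖) := by
            gcongr
            rw [← Real.norm_eq_abs]
            calc ‖fderiv ℝ (newtonFarLaplacian R (2 * R)) (y - x) (u x)‖ ≤ ‖fderiv ℝ (newtonFarLaplacian R (2 * R)) (y - x)‖ * ‖u x‖ :=
                  ContinuousLinearMap.le_opNorm _ _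
              _ ≤ R⁻¹ ^ 4 * M₁ * ‖u x‖ :=
                  mul_le_mul_of_nonneg_right (norm_fderiv_newtonFarLaplacian_scale_le hR hM₁ _)
                    (norm_nonneg _)
        _ = ‖a‖ * (R⁻¹ ^ 4 * M₁) * ‖u x‖ ^ 2 := by ring
    · rw [indicator_of_notMem hx,
        fderiv_of_notMem_tsupport ℝ (notMem_tsupport_newtonFarLaplacian_of_notMem hR hx)]
      simp
  rw [← Real.norm_eq_abs]
  calc ‖∫ x, ⟪u x, (fderiv ℝ (fun x => (newtonFarLaplacian R (2 * R)) (y - x)) x (u x)) • a⟫‖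
      ≤ ‖a‖ * (R⁻¹ ^ 4 * M₁) * ∫ x in closedBall y (2 * R), ‖u x‖ ^ 2 :=
        norm_integral_le_of_indicator_closedBall_le (hu.continuous.norm.pow 2) hdom
    _ = _ := by ring

/-- **The Calderón–Zygmund term**: `|∫ λᴿ(z) ∂ₐP(y−z) dz| ≤ ‖a‖ R⁻⁴M₁ ∫_{B̄(y,2R)} |P|` (move
`∂ₐ` onto the kernel). [folklore] -/
theorem abs_integral_newtonFarLaplacian_mul_fderiv_le (hR : 0 < R)
    (hM₁ : ∀ z : EuclideanSpace ℝ (Fin 3), ‖fderiv ℝ (newtonFarLaplacian 1 2) z‖ ≤ M₁)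
    {P : EuclideanSpace ℝ (Fin 3) → ℝ} (hP : ContDiff ℝ 1 P) :
    |∫ z, newtonFarLaplacian R (2 * R) z * fderiv ℝ P (y - z) a| ≤
      ‖a‖ * (R⁻¹ ^ 4 * M₁ * ∫ w in closedBall y (2 * R), |P w|) := by
  have h2R : R < 2 * R := by linarith
  have hlam1 : ContDiff ℝ 1 (newtonFarLaplacian R (2 * R)) := contDiff_newtonFarLaplacian hR h2R
  have hlamc : HasCompactSupport (newtonFarLaplacian R (2 * R)) := hasCompactSupport_newtonFarLaplacian hR.le h2R
  have hM₁0 : 0 ≤ M₁ := (norm_nonneg _).trans (hM₁ 0)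
  rw [← integral_fderiv_mul_comp_sub hlam1 hlamc hP y a]
  have hcv : ∫ z, fderiv ℝ (newtonFarLaplacian R (2 * R)) z a * P (y - z) = ∫ w, fderiv ℝ (newtonFarLaplacian R (2 * R)) (y - w) a * P w := by
    have h := integral_sub_left_eq_self (fun z => fderiv ℝ (newtonFarLaplacian R (2 * R)) z a * P (y - z)) volume y
    simp only [sub_sub_cancel] at h
    exact h.symm
  rw [hcv]
  have hdom : ∀ w, ‖fderiv ℝ (newtonFarLaplacian R (2 * R)) (y - w) a * P w‖ ≤
      (closedBall y (2 * R)).indicator (fun w => ‖a‖ * (R⁻¹ ^ 4 * M₁) * |P w|) w := by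
    intro w
    by_cases hw : w ∈ closedBall y (2 * R)
    · rw [indicator_of_mem hw, norm_mul, Real.norm_eq_abs, Real.norm_eq_abs]
      refine mul_le_mul_of_nonneg_right ?_ (abs_nonneg _)
      rw [← Real.norm_eq_abs]
      calc ‖fderiv ℝ (newtonFarLaplacian R (2 * R)) (y - w) a‖ ≤ ‖fderiv ℝ (newtonFarLaplacian R (2 * R)) (y - w)‖ * ‖a‖ := ContinuousLinearMap.le_opNorm _ _
        _ ≤ R⁻¹ ^ 4 * M₁ * ‖a‖ :=
            mul_le_mul_of_nonneg_right (norm_fderiv_newtonFarLaplacian_scale_le hR hM₁ _) (norm_nonneg _)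
        _ = ‖a‖ * (R⁻¹ ^ 4 * M₁) := by ring
    · rw [indicator_of_notMem hw,
        fderiv_of_notMem_tsupport ℝ (notMem_tsupport_newtonFarLaplacian_of_notMem hR hw),
        _root_.zero_apply, zero_mul, norm_zero]
  rw [← Real.norm_eq_abs]
  calc ‖∫ w, fderiv ℝ (newtonFarLaplacian R (2 * R)) (y - w) a * P w‖
      ≤ ‖a‖ * (R⁻¹ ^ 4 * M₁) * ∫ w in closedBall y (2 * R), |P w| :=
        norm_integral_le_of_indicator_closedBall_le (hP.continuous.abs) hdom
    _ = _ := by ring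

end Terms

/-! ### The interior gradient bound -/

/-- `|A − B − C| ≤ a + b + c` from `|A| ≤ a`, `|B| ≤ b`, `|C| ≤ c`. [folklore] -/
theorem abs_sub_sub_le_of_abs_le {A B C a b c : ℝ} (hA : |A| ≤ a) (hB : |B| ≤ b) (hC : |C| ≤ c) :
    |A - B - C| ≤ a + b + c := by
  have h1 := abs_sub (A - B) C
  have h2 := abs_sub A B
  linarith

/-- The steady Navier–Stokes equations in the profile class at rate `0`, viscosity `1`, solved
for the pressure gradient: `∇p = Δu − (u·∇)u` pointwise. [folklore] -/
theorem IsLerayProfile.gradient_eq_of_steady {u : EuclideanSpace ℝ (Fin 3) → EuclideanSpace ℝ (Fin 3)}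
    {p : EuclideanSpace ℝ (Fin 3) → ℝ} (h : IsLerayProfile 1 0 u p) (x : EuclideanSpace ℝ (Fin 3)) :
    gradient p x = (Δ u) x - convect u u x := by
  have h1 : (Δ u) x = convect u u x + gradient p x := by
    have := h.profile_eq x
    simp only [one_smul, zero_smul, add_zero] at this
    rw [add_assoc] at this
    exact neg_add_eq_zero.1 this
  rw [h1, add_sub_cancel_left]

/-- **Interior gradient bound for the harmonic part of the pressure of a steady solution.** Let
`(u, p)` be a classical steady Navier–Stokes solution on `ℝ³` (`IsLerayProfile 1 0 u p`; here
`u, p ∈ C²`), `P ∈ C²`, `R > 0`, and assume `h = p − P` is harmonic on `B(y, 4R)`. Then for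
every direction `a`,
`|Dh(y) a| ≤ ‖a‖(R⁻⁵M₂ ∫_{B̄(y,2R)}|u| + R⁻⁴M₁ ∫_{B̄(y,2R)}|u|² + R⁻⁴M₁ ∫_{B̄(y,2R)}|P|)`
with `M₁ ≥ sup‖Dλ^{1,2}‖`, `M₂ ≥ sup|Δλ^{1,2}|`. (Mean-value formula for `Dh` on the ball,
`∇p = Δu − (u·∇)u`, and the three kernel estimates above; Gilbarg–Trudinger Thm 2.10 combined with
the steady equation, as in Galdi's treatment of the pressure of `D`-solutions.)
[cite: Galdi2011, Thm X.9.5 (proof)] -/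
theorem abs_fderiv_sub_apply_le_of_steady {u : EuclideanSpace ℝ (Fin 3) → EuclideanSpace ℝ (Fin 3)}
    {p P : EuclideanSpace ℝ (Fin 3) → ℝ} (hprof : IsLerayProfile 1 0 u p) (hp : ContDiff ℝ 2 p)
    (hP : ContDiff ℝ 2 P) {R : ℝ} (hR : 0 < R) {y : EuclideanSpace ℝ (Fin 3)}
    (hΔ : ∀ w ∈ ball y (4 * R), (Δ (fun x => p x - P x)) w = 0) {M₁ M₂ : ℝ}
    (hM₁ : ∀ z : EuclideanSpace ℝ (Fin 3), ‖fderiv ℝ (newtonFarLaplacian 1 2) z‖ ≤ M₁)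
    (hM₂ : ∀ z : EuclideanSpace ℝ (Fin 3), |(Δ (newtonFarLaplacian 1 2)) z| ≤ M₂)
    (a : EuclideanSpace ℝ (Fin 3)) :
    |fderiv ℝ (fun x => p x - P x) y a| ≤
      ‖a‖ * (R⁻¹ ^ 5 * M₂ * ∫ w in closedBall y (2 * R), ‖u w‖) +
        ‖a‖ * (R⁻¹ ^ 4 * M₁ * ∫ w in closedBall y (2 * R), ‖u w‖ ^ 2) +
        ‖a‖ * (R⁻¹ ^ 4 * M₁ * ∫ w in closedBall y (2 * R), |P w|) := by
  have hu : ContDiff ℝ 2 u := hprof.contDiff_velocity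
  have h2R : R < 2 * R := by linarith
  have h4R : 2 * R < 4 * R := by linarith
  have hlam2 : ContDiff ℝ 2 (newtonFarLaplacian R (2 * R)) := contDiff_newtonFarLaplacian hR h2R
  have hlamc : HasCompactSupport (newtonFarLaplacian R (2 * R)) := hasCompactSupport_newtonFarLaplacian hR.le h2R
  have hh2 : ContDiff ℝ 2 fun x => p x - P x := hp.sub hP
  -- mean-value formula for the gradient
  have key := fderiv_apply_eq_integral_newtonFarLaplacian_mul_fderiv hR h2R hh2 h4R hΔ a
  -- `∂ₐ(p − P)(x) = ⟪a, Δu x⟫ − ⟪a, (u·∇)u x⟫ − ∂ₐP x`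
  have hpd : Differentiable ℝ p := hp.differentiable (by norm_num)
  have hPd : Differentiable ℝ P := hP.differentiable (by norm_num)
  have hder : ∀ x, fderiv ℝ (fun x => p x - P x) x a = ⟪a, (Δ u) x⟫ - ⟪a, convect u u x⟫ - fderiv ℝ P x a := by
    intro x
    have h1 : fderiv ℝ (fun x => p x - P x) x = fderiv ℝ p x - fderiv ℝ P x := fderiv_fun_sub (hpd x) (hPd x)
    have h2 : fderiv ℝ p x a = ⟪gradient p x, a⟫ := by
      rw [gradient, InnerProductSpace.toDual_symm_apply]
    have h3 : gradient p x = (Δ u) x - convect u u x := hprof.gradient_eq_of_steady x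
    rw [h1, _root_.sub_apply, h2, h3, inner_sub_left, real_inner_comm a,
      real_inner_comm a]
  -- split the integral
  have hcΔ : Continuous fun x => ⟪a, (Δ u) x⟫ :=
    continuous_const.inner (FluidPDE.continuous_laplacian hu)
  have hcC : Continuous fun x => ⟪a, convect u u x⟫ :=
    continuous_const.inner (((hu.continuous_fderiv (by norm_num)).clm_apply hu.continuous))
  have hcP : Continuous fun x => fderiv ℝ P x a :=
    (hP.continuous_fderiv (by norm_num)).clm_apply continuous_const
  have hcont : ∀ (g : EuclideanSpace ℝ (Fin 3) → ℝ), Continuous g →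
      Integrable (fun z => (newtonFarLaplacian R (2 * R)) z * g (y - z)) := fun g hg => by
    have := integrable_smul_comp_sub (integrable_newtonFarLaplacian hR h2R)
      (fun z hz => newtonFarLaplacian_eq_zero_of_gt hR.le h2R hz) hg y
    simpa only [smul_eq_mul] using this
  -- (the `have … ; exact` form keeps the elaborator from unfolding the kernel)
  have i1 : Integrable fun z => (newtonFarLaplacian R (2 * R)) z * ⟪a, (Δ u) (y - z)⟫ := by
    have := hcont (fun x => ⟪a, (Δ u) x⟫) hcΔ
    exact this
  have i2 : Integrable fun z => (newtonFarLaplacian R (2 * R)) z * ⟪a, convect u u (y - z)⟫ := by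
    have := hcont (fun x => ⟪a, convect u u x⟫) hcC
    exact this
  have i3 : Integrable fun z => (newtonFarLaplacian R (2 * R)) z * fderiv ℝ P (y - z) a := by
    have := hcont (fun x => fderiv ℝ P x a) hcP
    exact this
  have hsplit : ∫ z, (newtonFarLaplacian R (2 * R)) z * fderiv ℝ (fun x => p x - P x) (y - z) a =
      (∫ z, (newtonFarLaplacian R (2 * R)) z * ⟪a, (Δ u) (y - z)⟫) - (∫ z, (newtonFarLaplacian R (2 * R)) z * ⟪a, convect u u (y - z)⟫) -
        ∫ z, (newtonFarLaplacian R (2 * R)) z * fderiv ℝ P (y - z) a := by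
    simp_rw [hder, mul_sub]
    have i12 : Integrable fun z => (newtonFarLaplacian R (2 * R)) z * ⟪a, (Δ u) (y - z)⟫ -
        (newtonFarLaplacian R (2 * R)) z * ⟪a, convect u u (y - z)⟫ := by
      have := i1.sub i2
      exact this
    rw [integral_sub i12 i3, integral_sub i1 i2]
  rw [key, hsplit]
  have T1 := abs_integral_newtonFarLaplacian_mul_inner_laplacian_le (y := y) (a := a) hR hM₂ hu
  have T2 := abs_integral_newtonFarLaplacian_mul_inner_convect_le (y := y) (a := a) hR hM₁ hu hprof.divFree
  have T3 := abs_integral_newtonFarLaplacian_mul_fderiv_le (y := y) (a := a) hR hM₁ (hP.of_le one_le_two)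
  exact abs_sub_sub_le_of_abs_le T1 T2 T3

end Literature.Analysis.FluidPDE

end
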